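import Summits.Ventures.HodgeRepro.Night3FaceClosureTwist
import Summits.Ventures.HodgeRepro.Night3CensusDistinctModel
import Summits.Ventures.HodgeRepro.Night3CensusCover8
import Summits.Ventures.HodgeRepro.Night3CensusCover12a
import Summits.Ventures.HodgeRepro.Night3CensusCover12b

/-!
# Every face is the Galois twist of EXACTLY ONE sealed representative (kernel)

Blind re-derivation cell `pub-hodge-repro`, seat `night-3` (gen 3).  Imports night-3's `Night3FaceClosureTwist`
(`twistMul`), `Night3CensusDistinctModel` (`cornersMul_ne_twistMul_of_repsDistinct`, `reps_mem_faces_<row>`) and the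
three cover files (`coversFaces_<row>`).  Namespace `HodgeRepro.Night3.Census`.

`existsUnique_rep` (generic in a Cayley table `Γ` with `coversFaces Γ reps = true` and `repsDistinct Γ reps = true`,
every representative an engine face) and its eleven sealed instances say: for every face `(Φ; p, p')` of the model there
is EXACTLY ONE position `i` in the sealed list such that the corner multiset of the face is a Galois twist of the corner
multiset of `reps[i]`.  So the faces of the row fall into exactly `reps.length` twist classes of corner multisets and the
sealed list enumerates them once each: the open input `hreps` of `alg_of_reps_<row>` is S4 on exactly
1 / 3, 4, 4, 6, 5, 3 / 20, 22, 26, 20 faces, no more and no fewer.  Nothing here closes S4; no sealed file is touched;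
no Tier-2 item depends on this file.
-/

set_option autoImplicit false

namespace HodgeRepro.Night3.Census

open Summit.Ventures.HodgeRepro.FaceCensus
open HodgeRepro.EngineBridge
open HodgeRepro.Night3.GSet

variable {n : ℕ}

section Good

variable (Γ : CMGaloisType n) [Fact (Γ.isCMGaloisType = true)]

/-- **Exactly one representative per face**: with `coversFaces` and `repsDistinct` decided and every representative an
engine face, every model face `(Φ; p, p')` is the twist of the corner multiset of exactly one position of `reps`. -/
theorem existsUnique_rep (reps : List (ℕ × ℕ × ℕ)) (hcov : coversFaces Γ reps = true)
    (hd : repsDistinct Γ reps = true) (hf : ∀ r ∈ reps, r ∈ Γ.faces)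
    (Φ : Finset (Elt Γ)) (p p' : Elt Γ) (hΦ : IsCMType (Elt.conj Γ) Φ) (hp : p' ∉ place (Elt.conj Γ) p) :
    ∃! i : Fin reps.length, ∃ g : Elt Γ,
      faceCornersMul (Elt.conj Γ) Φ p p' = twistMul (cornersMul Γ (reps.getD i.val (0, 0, 0))) g := by
  obtain ⟨r, hr, g, e⟩ := cover_of_coversFaces Γ reps hcov Φ p p' hΦ hp
  obtain ⟨i, hi, rfl⟩ := List.getElem_of_mem hr
  refine ⟨⟨i, hi⟩, ⟨g, ?_⟩, ?_⟩
  · rw [List.getD_eq_getElem?_getD, List.getElem?_eq_getElem hi]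
    exact e
  · rintro ⟨j, hj⟩ ⟨h, e'⟩
    by_contra hne
    have hne' : j ≠ i := fun h' => hne (Fin.ext h')
    have e1 : faceCornersMul (Elt.conj Γ) Φ p p' = twistMul (cornersMul Γ (reps.getD i (0, 0, 0))) g := by
      rw [List.getD_eq_getElem?_getD, List.getElem?_eq_getElem hi]
      exact e
    -- `cornersMul reps[j] = (cornersMul reps[i])·(g h⁻¹)`
    have key : cornersMul Γ (reps.getD j (0, 0, 0)) =
        twistMul (cornersMul Γ (reps.getD i (0, 0, 0))) (g * h⁻¹) := by
      have := congrArg (fun M => twistMul M h⁻¹) (e'.symm.trans e1)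
      simpa only [twistMul_twistMul, mul_inv_cancel, twistMul_one] using this
    exact cornersMul_ne_twistMul_of_repsDistinct Γ reps hd hf hj hi hne' (g * h⁻¹) key

end Good

/-- Row `Sextic.Cyclic`: every face is the twist of exactly one sealed representative. -/
theorem existsUnique_rep_sexticCyclic (Φ : Finset (Elt Sextic.Cyclic.Γ)) (p p' : Elt Sextic.Cyclic.Γ)
    (hΦ : IsCMType (Elt.conj Sextic.Cyclic.Γ) Φ) (hp : p' ∉ place (Elt.conj Sextic.Cyclic.Γ) p) :
    ∃! i : Fin Sextic.Cyclic.reps.length, ∃ g : Elt Sextic.Cyclic.Γ,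
      faceCornersMul (Elt.conj Sextic.Cyclic.Γ) Φ p p' =
        twistMul (cornersMul Sextic.Cyclic.Γ (Sextic.Cyclic.reps.getD i.val (0, 0, 0))) g :=
  existsUnique_rep Sextic.Cyclic.Γ Sextic.Cyclic.reps coversFaces_sexticCyclic repsDistinct_sexticCyclic reps_mem_faces_sexticCyclic Φ p p' hΦ hp

/-- Row `Octic.Cyclic`: every face is the twist of exactly one sealed representative. -/
theorem existsUnique_rep_octicCyclic (Φ : Finset (Elt Octic.Cyclic.Γ)) (p p' : Elt Octic.Cyclic.Γ)
    (hΦ : IsCMType (Elt.conj Octic.Cyclic.Γ) Φ) (hp : p' ∉ place (Elt.conj Octic.Cyclic.Γ) p) :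
    ∃! i : Fin Octic.Cyclic.reps.length, ∃ g : Elt Octic.Cyclic.Γ,
      faceCornersMul (Elt.conj Octic.Cyclic.Γ) Φ p p' =
        twistMul (cornersMul Octic.Cyclic.Γ (Octic.Cyclic.reps.getD i.val (0, 0, 0))) g :=
  existsUnique_rep Octic.Cyclic.Γ Octic.Cyclic.reps coversFaces_octicCyclic repsDistinct_octicCyclic reps_mem_faces_octicCyclic Φ p p' hΦ hp

/-- Row `Octic.C4C2Square`: every face is the twist of exactly one sealed representative. -/
theorem existsUnique_rep_octicC4C2Square (Φ : Finset (Elt Octic.C4C2Square.Γ)) (p p' : Elt Octic.C4C2Square.Γ)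
    (hΦ : IsCMType (Elt.conj Octic.C4C2Square.Γ) Φ) (hp : p' ∉ place (Elt.conj Octic.C4C2Square.Γ) p) :
    ∃! i : Fin Octic.C4C2Square.reps.length, ∃ g : Elt Octic.C4C2Square.Γ,
      faceCornersMul (Elt.conj Octic.C4C2Square.Γ) Φ p p' =
        twistMul (cornersMul Octic.C4C2Square.Γ (Octic.C4C2Square.reps.getD i.val (0, 0, 0))) g :=
  existsUnique_rep Octic.C4C2Square.Γ Octic.C4C2Square.reps coversFaces_octicC4C2Square repsDistinct_octicC4C2Square reps_mem_faces_octicC4C2Square Φ p p' hΦ hp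

/-- Row `Octic.C4C2Nonsquare`: every face is the twist of exactly one sealed representative. -/
theorem existsUnique_rep_octicC4C2Nonsquare (Φ : Finset (Elt Octic.C4C2Nonsquare.Γ)) (p p' : Elt Octic.C4C2Nonsquare.Γ)
    (hΦ : IsCMType (Elt.conj Octic.C4C2Nonsquare.Γ) Φ) (hp : p' ∉ place (Elt.conj Octic.C4C2Nonsquare.Γ) p) :
    ∃! i : Fin Octic.C4C2Nonsquare.reps.length, ∃ g : Elt Octic.C4C2Nonsquare.Γ,
      faceCornersMul (Elt.conj Octic.C4C2Nonsquare.Γ) Φ p p' =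
        twistMul (cornersMul Octic.C4C2Nonsquare.Γ (Octic.C4C2Nonsquare.reps.getD i.val (0, 0, 0))) g :=
  existsUnique_rep Octic.C4C2Nonsquare.Γ Octic.C4C2Nonsquare.reps coversFaces_octicC4C2Nonsquare repsDistinct_octicC4C2Nonsquare reps_mem_faces_octicC4C2Nonsquare Φ p p' hΦ hp

/-- Row `Octic.Triquadratic`: every face is the twist of exactly one sealed representative. -/
theorem existsUnique_rep_octicTriquadratic (Φ : Finset (Elt Octic.Triquadratic.Γ)) (p p' : Elt Octic.Triquadratic.Γ)
    (hΦ : IsCMType (Elt.conj Octic.Triquadratic.Γ) Φ) (hp : p' ∉ place (Elt.conj Octic.Triquadratic.Γ) p) :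
    ∃! i : Fin Octic.Triquadratic.reps.length, ∃ g : Elt Octic.Triquadratic.Γ,
      faceCornersMul (Elt.conj Octic.Triquadratic.Γ) Φ p p' =
        twistMul (cornersMul Octic.Triquadratic.Γ (Octic.Triquadratic.reps.getD i.val (0, 0, 0))) g :=
  existsUnique_rep Octic.Triquadratic.Γ Octic.Triquadratic.reps coversFaces_octicTriquadratic repsDistinct_octicTriquadratic reps_mem_faces_octicTriquadratic Φ p p' hΦ hp

/-- Row `Octic.Dihedral`: every face is the twist of exactly one sealed representative. -/
theorem existsUnique_rep_octicDihedral (Φ : Finset (Elt Octic.Dihedral.Γ)) (p p' : Elt Octic.Dihedral.Γ)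
    (hΦ : IsCMType (Elt.conj Octic.Dihedral.Γ) Φ) (hp : p' ∉ place (Elt.conj Octic.Dihedral.Γ) p) :
    ∃! i : Fin Octic.Dihedral.reps.length, ∃ g : Elt Octic.Dihedral.Γ,
      faceCornersMul (Elt.conj Octic.Dihedral.Γ) Φ p p' =
        twistMul (cornersMul Octic.Dihedral.Γ (Octic.Dihedral.reps.getD i.val (0, 0, 0))) g :=
  existsUnique_rep Octic.Dihedral.Γ Octic.Dihedral.reps coversFaces_octicDihedral repsDistinct_octicDihedral reps_mem_faces_octicDihedral Φ p p' hΦ hp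

/-- Row `Octic.Quaternion`: every face is the twist of exactly one sealed representative. -/
theorem existsUnique_rep_octicQuaternion (Φ : Finset (Elt Octic.Quaternion.Γ)) (p p' : Elt Octic.Quaternion.Γ)
    (hΦ : IsCMType (Elt.conj Octic.Quaternion.Γ) Φ) (hp : p' ∉ place (Elt.conj Octic.Quaternion.Γ) p) :
    ∃! i : Fin Octic.Quaternion.reps.length, ∃ g : Elt Octic.Quaternion.Γ,
      faceCornersMul (Elt.conj Octic.Quaternion.Γ) Φ p p' =
        twistMul (cornersMul Octic.Quaternion.Γ (Octic.Quaternion.reps.getD i.val (0, 0, 0))) g :=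
  existsUnique_rep Octic.Quaternion.Γ Octic.Quaternion.reps coversFaces_octicQuaternion repsDistinct_octicQuaternion reps_mem_faces_octicQuaternion Φ p p' hΦ hp

/-- Row `Duodecic.Cyclic`: every face is the twist of exactly one sealed representative. -/
theorem existsUnique_rep_duodecicCyclic (Φ : Finset (Elt Duodecic.Cyclic.Γ)) (p p' : Elt Duodecic.Cyclic.Γ)
    (hΦ : IsCMType (Elt.conj Duodecic.Cyclic.Γ) Φ) (hp : p' ∉ place (Elt.conj Duodecic.Cyclic.Γ) p) :
    ∃! i : Fin Duodecic.Cyclic.reps.length, ∃ g : Elt Duodecic.Cyclic.Γ,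
      faceCornersMul (Elt.conj Duodecic.Cyclic.Γ) Φ p p' =
        twistMul (cornersMul Duodecic.Cyclic.Γ (Duodecic.Cyclic.reps.getD i.val (0, 0, 0))) g :=
  existsUnique_rep Duodecic.Cyclic.Γ Duodecic.Cyclic.reps coversFaces_duodecicCyclic repsDistinct_duodecicCyclic reps_mem_faces_duodecicCyclic Φ p p' hΦ hp

/-- Row `Duodecic.C6C2`: every face is the twist of exactly one sealed representative. -/
theorem existsUnique_rep_duodecicC6C2 (Φ : Finset (Elt Duodecic.C6C2.Γ)) (p p' : Elt Duodecic.C6C2.Γ)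
    (hΦ : IsCMType (Elt.conj Duodecic.C6C2.Γ) Φ) (hp : p' ∉ place (Elt.conj Duodecic.C6C2.Γ) p) :
    ∃! i : Fin Duodecic.C6C2.reps.length, ∃ g : Elt Duodecic.C6C2.Γ,
      faceCornersMul (Elt.conj Duodecic.C6C2.Γ) Φ p p' =
        twistMul (cornersMul Duodecic.C6C2.Γ (Duodecic.C6C2.reps.getD i.val (0, 0, 0))) g :=
  existsUnique_rep Duodecic.C6C2.Γ Duodecic.C6C2.reps coversFaces_duodecicC6C2 repsDistinct_duodecicC6C2 reps_mem_faces_duodecicC6C2 Φ p p' hΦ hp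

/-- Row `Duodecic.Dihedral`: every face is the twist of exactly one sealed representative. -/
theorem existsUnique_rep_duodecicDihedral (Φ : Finset (Elt Duodecic.Dihedral.Γ)) (p p' : Elt Duodecic.Dihedral.Γ)
    (hΦ : IsCMType (Elt.conj Duodecic.Dihedral.Γ) Φ) (hp : p' ∉ place (Elt.conj Duodecic.Dihedral.Γ) p) :
    ∃! i : Fin Duodecic.Dihedral.reps.length, ∃ g : Elt Duodecic.Dihedral.Γ,
      faceCornersMul (Elt.conj Duodecic.Dihedral.Γ) Φ p p' =
        twistMul (cornersMul Duodecic.Dihedral.Γ (Duodecic.Dihedral.reps.getD i.val (0, 0, 0))) g :=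
  existsUnique_rep Duodecic.Dihedral.Γ Duodecic.Dihedral.reps coversFaces_duodecicDihedral repsDistinct_duodecicDihedral reps_mem_faces_duodecicDihedral Φ p p' hΦ hp

/-- Row `Duodecic.Dicyclic`: every face is the twist of exactly one sealed representative. -/
theorem existsUnique_rep_duodecicDicyclic (Φ : Finset (Elt Duodecic.Dicyclic.Γ)) (p p' : Elt Duodecic.Dicyclic.Γ)
    (hΦ : IsCMType (Elt.conj Duodecic.Dicyclic.Γ) Φ) (hp : p' ∉ place (Elt.conj Duodecic.Dicyclic.Γ) p) :
    ∃! i : Fin Duodecic.Dicyclic.reps.length, ∃ g : Elt Duodecic.Dicyclic.Γ,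
      faceCornersMul (Elt.conj Duodecic.Dicyclic.Γ) Φ p p' =
        twistMul (cornersMul Duodecic.Dicyclic.Γ (Duodecic.Dicyclic.reps.getD i.val (0, 0, 0))) g :=
  existsUnique_rep Duodecic.Dicyclic.Γ Duodecic.Dicyclic.reps coversFaces_duodecicDicyclic repsDistinct_duodecicDicyclic reps_mem_faces_duodecicDicyclic Φ p p' hΦ hp

end HodgeRepro.Night3.Census
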